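import Summits.QuantumFields.BalabanUV.InfraRed.StrongCouplingDimensionalCurvature

/-!
# Strong-coupling front, J-SC13 (part 1/3): the TWISTED pointwise Bochner inequality for a
one-link potential on `SU(2)` — observatory of the non-perturbative crossover; no mass-gap claim

IR-3 v2 TWO-FRONT CROSSOVER LEDGER, front SC (`β₀`), SU(2), `d = 4`, Wilson normalisation `β_W = 4/g²`.
observatory of the non-perturbative crossover; no mass-gap claim.

ABSOLUTE RULE. No internally-minted statement may enter as a cited fact. Every hypothesis is either
kernel-proved in this package or a verbatim quotation of a PUBLISHED theorem with page reference. The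
manuscript(s) under audit are NOT citable for their own disputed steps — they are the thing under
adjudication; programme-internal (2001/route/tribunal) claims are never citable.  THIS FILE HAS NO
HYPOTHESES: every statement below is kernel-proved from the tree; names of published results appear as
ATTRIBUTION only (Bochner–Lichnerowicz–Bakry–Émery `Γ₂`-calculus; the "twisted" or intertwining
variant of the Bochner identity).

WHAT THIS FILE PROVES (all in the tree's frame calculus `SUNBakryEmery.matD/Gam/Lap/genL/Gam2` on
`M₂(ℂ) ⊃ SU(2)`; `S` smooth, later `S = pot c B = c Re tr(· B)`; `a_α = D_α u`, `s_α = D_α S`,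
`m_{αβ} = D_α D_β u`):
* `sq_sum_diag_add_anti_le` (frame algebra, `dim 𝔰𝔲(2) = 3`): for a kernel `τ` odd in each slot,
  `(∑_α τ_{αα})²/3 + ¼ ∑_{αβ} (τ_{αβ} - τ_{βα})² ≤ ∑_{αβ} τ_{αβ}²`;
* `Lap_potential_two` (Casimir): `Δ S = -(3/2) S` for `S = c Re tr(· B)` on all of `M₂(ℂ)`;
* `sum_sum_comm_mul_eq_zero_left/right` (total antisymmetry of the structure constants):
  `∑_{αβ} ([D_α,D_β]u) s_α a_β = ∑_{αβ} ([D_α,D_β]u) s_β a_α = 0`;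
* `Gam_Gam_self_eq`, `Gam_Gam_left_eq`: `Γ(S,Γ(u,u)) = 2∑ s_α a_β m_{αβ}`,
  `Γ(Γ(S,u),u) = ∑ a_α a_β D_αD_β S + ½ Γ(S,Γ(u,u))`;
* `Gam_le_twisted`: the POINTWISE twisted Bochner inequality with the twist `T_{αβ} = m_{αβ} + (2/5) s_α a_β`:
  `Γ(u,u) ≤ Γ₂(u) + H + (2/5)Γ(S,Γ(u,u)) + (1/5)Γ(S,S)Γ(u,u) - (L_S u)²/3 + (2/5)(L_S u)Γ(S,u)`,
  `H = ∑ a_α a_β D_αD_β S` (`= -(S/2)Γ(u,u)` for the potential, `Gam_le_twisted_pot`), and the potential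
  identities `Gam_Gam_left_pot`, `genL_pot_self` (`L_S S = -(3/2)S + Γ(S,S)`).
Part 2/3 (`StrongCouplingSharpCurvature`) integrates this against `e^S dσ` — every potential term cancels
at the twist `2/5`, leaving `(3/2) ∫ e^S Γ(u,u) dσ ≤ ∫ e^S (L_S u)² dσ` for EVERY `c`, `B` (the Haar
constant); part 3/3 (`StrongCouplingSharpWindow`) turns that into `OneLinkPoincareSU2 R (2/3)` for every
`R` and the hypothesis-free window `β_W < √3/9 = 0.19245` of the ledger.
-/

noncomputable section

open scoped Matrix ComplexConjugate BigOperators Matrix.Norms.Frobenius ContDiff Topology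
open Matrix Complex Finset MeasureTheory
open Literature.MathematicalPhysics.QuantumFieldTheory
open Literature.MathematicalPhysics.QuantumFieldTheory.SUNBakryEmery
open Summit.QuantumFields.BalabanUV.InfraRed.StrongCouplingDimensionalCurvature

namespace Summit.QuantumFields.BalabanUV.InfraRed.StrongCouplingSharpTwist

variable {N : ℕ}

/-! ## Part A: frame algebra -/

/-- **The dimensional bound with the antisymmetric part retained** (`dim 𝔰𝔲(2) = 3`): for a real
kernel `τ` on `M₂(ℂ) × M₂(ℂ)` that is odd in each slot, summed over the tree's 8-element Parseval frame
of `𝔰𝔲(2)`, `(∑_α τ(Y_α,Y_α))²/3 + ¼ ∑_{αβ} (τ(Y_α,Y_β) - τ(Y_β,Y_α))² ≤ ∑_{αβ} τ(Y_α,Y_β)²`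
(symmetric/antisymmetric split; the symmetric part reduces to the core `{A, B, C}` where
`‖sym‖² ≥ (tr)²/3`). [folklore] -/
theorem sq_sum_diag_add_anti_le {τ : Matrix (Fin 2) (Fin 2) ℂ → Matrix (Fin 2) (Fin 2) ℂ → ℝ}
    (h1 : ∀ X Y, τ (-X) Y = -τ X Y) (h2 : ∀ X Y, τ X (-Y) = -τ X Y) :
    (∑ α, τ (frame α) (frame α)) ^ 2 / 3 +
        (1 / 4) * ∑ α, ∑ β, (τ (frame α) (frame β) - τ (frame β) (frame α)) ^ 2 ≤
      ∑ α, ∑ β, τ (frame α) (frame β) ^ 2 := by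
  have h0l : ∀ Y, τ 0 Y = 0 := fun Y => by
    have h := h1 0 Y
    rw [neg_zero] at h
    linarith
  have h0r : ∀ X, τ X 0 = 0 := fun X => by
    have h := h2 X 0
    rw [neg_zero] at h
    linarith
  -- symmetric / antisymmetric split
  have split : ∑ α, ∑ β, τ (frame (N := 2) α) (frame β) ^ 2 =
      (1 / 4) * ∑ α, ∑ β, (τ (frame (N := 2) α) (frame β) + τ (frame β) (frame α)) ^ 2 +
        (1 / 4) * ∑ α, ∑ β, (τ (frame (N := 2) α) (frame β) - τ (frame β) (frame α)) ^ 2 := by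
    have h : (1 / 4) * ∑ α, ∑ β, (τ (frame (N := 2) α) (frame β) + τ (frame β) (frame α)) ^ 2 +
        (1 / 4) * ∑ α, ∑ β, (τ (frame (N := 2) α) (frame β) - τ (frame β) (frame α)) ^ 2 =
        (1 / 2) * ∑ α, ∑ β, τ (frame (N := 2) α) (frame β) ^ 2 +
          (1 / 2) * ∑ α, ∑ β, τ (frame (N := 2) β) (frame α) ^ 2 := by
      rw [mul_sum, mul_sum, mul_sum, mul_sum, ← sum_add_distrib, ← sum_add_distrib]
      refine sum_congr rfl fun α _ => ?_
      rw [mul_sum, mul_sum, mul_sum, mul_sum, ← sum_add_distrib, ← sum_add_distrib]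
      refine sum_congr rfl fun β _ => ?_
      ring
    rw [h, sum_comm (f := fun α β => τ (frame (N := 2) β) (frame α) ^ 2)]
    ring
  -- the diagonal on the core
  have diag : ∑ α, τ (frame (N := 2) α) (frame α) =
      2 * (τ (frameA 0 1) (frameA 0 1) + τ (frameB 0 1) (frameB 0 1) + τ (frameB 0 0) (frameB 0 0)) :=
    sum_frame_two (g := fun Y => τ Y Y) (fun X => by show τ (-X) (-X) = τ X X; rw [h1, h2, neg_neg])
      (by show τ 0 0 = 0; exact h0l 0)
  -- the symmetric part on the core
  have hin : ∀ X : Matrix (Fin 2) (Fin 2) ℂ, ∑ β, (τ X (frame (N := 2) β) + τ (frame β) X) ^ 2 =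
      2 * ((τ X (frameA 0 1) + τ (frameA 0 1) X) ^ 2 + (τ X (frameB 0 1) + τ (frameB 0 1) X) ^ 2 +
        (τ X (frameB 0 0) + τ (frameB 0 0) X) ^ 2) := fun X =>
    sum_frame_two (g := fun Y => (τ X Y + τ Y X) ^ 2)
      (fun Y => by show (τ X (-Y) + τ (-Y) X) ^ 2 = (τ X Y + τ Y X) ^ 2; rw [h2, h1]; ring)
      (by show (τ X 0 + τ 0 X) ^ 2 = 0; rw [h0r, h0l]; ring)
  have sym : ∑ α, ∑ β, (τ (frame (N := 2) α) (frame β) + τ (frame β) (frame α)) ^ 2 =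
      4 * ((2 * τ (frameA 0 1) (frameA 0 1)) ^ 2 + (2 * τ (frameB 0 1) (frameB 0 1)) ^ 2 +
        (2 * τ (frameB 0 0) (frameB 0 0)) ^ 2 +
        2 * (τ (frameA 0 1) (frameB 0 1) + τ (frameB 0 1) (frameA 0 1)) ^ 2 +
        2 * (τ (frameA 0 1) (frameB 0 0) + τ (frameB 0 0) (frameA 0 1)) ^ 2 +
        2 * (τ (frameB 0 1) (frameB 0 0) + τ (frameB 0 0) (frameB 0 1)) ^ 2) := by
    simp_rw [hin]
    rw [sum_frame_two (g := fun X => 2 * ((τ X (frameA 0 1) + τ (frameA 0 1) X) ^ 2 +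
        (τ X (frameB 0 1) + τ (frameB 0 1) X) ^ 2 + (τ X (frameB 0 0) + τ (frameB 0 0) X) ^ 2))]
    · ring
    · intro X
      show 2 * ((τ (-X) (frameA 0 1) + τ (frameA 0 1) (-X)) ^ 2 + (τ (-X) (frameB 0 1) + τ (frameB 0 1) (-X)) ^ 2 +
          (τ (-X) (frameB 0 0) + τ (frameB 0 0) (-X)) ^ 2) = _
      rw [h1, h1, h1, h2, h2, h2]
      ring
    · show 2 * ((τ 0 (frameA 0 1) + τ (frameA 0 1) 0) ^ 2 + (τ 0 (frameB 0 1) + τ (frameB 0 1) 0) ^ 2 +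
          (τ 0 (frameB 0 0) + τ (frameB 0 0) 0) ^ 2) = 0
      rw [h0l, h0l, h0l, h0r, h0r, h0r]
      ring
  rw [split, sym, diag]
  nlinarith [sq_nonneg (τ (frameA 0 1) (frameA 0 1) - τ (frameB 0 1) (frameB 0 1)),
    sq_nonneg (τ (frameA 0 1) (frameA 0 1) - τ (frameB 0 0) (frameB 0 0)),
    sq_nonneg (τ (frameB 0 1) (frameB 0 1) - τ (frameB 0 0) (frameB 0 0)),
    sq_nonneg (τ (frameA 0 1) (frameB 0 1) + τ (frameB 0 1) (frameA 0 1)),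
    sq_nonneg (τ (frameA 0 1) (frameB 0 0) + τ (frameB 0 0) (frameA 0 1)),
    sq_nonneg (τ (frameB 0 1) (frameB 0 0) + τ (frameB 0 0) (frameB 0 1))]

/-- **Casimir at `N = 2`**: the Laplacian of the one-link potential is `Δ S = -(3/2) S` on all of
`M₂(ℂ)` (`∑_α Y_α² = -(3/2)·1`, the tree's `sum_frame_mul_frame`). [folklore] -/
theorem Lap_potential_two (c : ℝ) (B Q : Matrix (Fin 2) (Fin 2) ℂ) :
    Lap (fun Q => c * (Q * B).trace.re) Q = -(3 / 2) * (c * (Q * B).trace.re) := by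
  show ∑ α, matD (frame α) (matD (frame α) (fun Q => c * (Q * B).trace.re)) Q = _
  simp_rw [matD_matD_potential]
  have hC : ∑ α, frame (N := 2) α * frame α = ((-(3 / 2) : ℝ) : ℂ) • (1 : Matrix (Fin 2) (Fin 2) ℂ) := by
    rw [sum_frame_mul_frame two_ne_zero, ← neg_smul]
    congr 1
    push_cast
    norm_num
  have hsum : ∑ α, Q * frame (N := 2) α * frame α * B = Q * (∑ α, frame α * frame α) * B := by
    rw [Finset.mul_sum, Finset.sum_mul]
    exact sum_congr rfl fun α _ => by rw [Matrix.mul_assoc Q (frame α) (frame α)]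
  calc ∑ α, c * (Q * frame (N := 2) α * frame α * B).trace.re
      = c * (∑ α, Q * frame (N := 2) α * frame α * B).trace.re := by
        rw [trace_sum, Complex.re_sum, mul_sum]
    _ = -(3 / 2) * (c * (Q * B).trace.re) := by
        rw [hsum, hC, Matrix.mul_smul, Matrix.mul_one, Matrix.smul_mul, trace_smul, smul_eq_mul,
          Complex.re_ofReal_mul]
        ring

section Calculus

attribute [local instance 2000] matTop

variable {u S : Matrix (Fin N) (Fin N) ℂ → ℝ}

/-- `∑_{αβ} ([D_α, D_β] u) · s_β · D_α u = 0` for any coefficients `s` (the structure constants are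
totally antisymmetric). [folklore] -/
theorem sum_sum_comm_mul_eq_zero_right (hN : N ≠ 0) (hu : ContDiff ℝ ∞ u) (s : FrameIdx N → ℝ)
    (Q : Matrix (Fin N) (Fin N) ℂ) :
    ∑ α, ∑ β, (matD (frame α) (matD (frame β) u) Q - matD (frame β) (matD (frame α) u) Q) *
      (s β * matD (frame α) u Q) = 0 := by
  simp_rw [matD_matD_sub_eq_sum_strC hN hu]
  rw [sum_comm]
  refine sum_eq_zero fun β _ => ?_
  have h : ∑ α, (∑ γ, strC α β γ * matD (frame γ) u Q) * (s β * matD (frame α) u Q) =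
      s β * ∑ α, ∑ γ, strC α β γ * (matD (frame α) u Q * matD (frame γ) u Q) := by
    rw [mul_sum]
    refine sum_congr rfl fun α _ => ?_
    rw [sum_mul, mul_sum]
    exact sum_congr rfl fun γ _ => by ring
  rw [h, sum_sum_eq_zero_of_antisymm (fun α γ => strC_swap13 α β γ) (fun α γ => mul_comm _ _), mul_zero]

/-- `∑_{αβ} ([D_α, D_β] u) · s_α · D_β u = 0` for any coefficients `s`. [folklore] -/
theorem sum_sum_comm_mul_eq_zero_left (hN : N ≠ 0) (hu : ContDiff ℝ ∞ u) (s : FrameIdx N → ℝ)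
    (Q : Matrix (Fin N) (Fin N) ℂ) :
    ∑ α, ∑ β, (matD (frame α) (matD (frame β) u) Q - matD (frame β) (matD (frame α) u) Q) *
      (s α * matD (frame β) u Q) = 0 := by
  simp_rw [matD_matD_sub_eq_sum_strC hN hu]
  refine sum_eq_zero fun α _ => ?_
  have h : ∑ β, (∑ γ, strC α β γ * matD (frame γ) u Q) * (s α * matD (frame β) u Q) =
      s α * ∑ β, ∑ γ, strC α β γ * (matD (frame β) u Q * matD (frame γ) u Q) := by
    rw [mul_sum]
    refine sum_congr rfl fun β _ => ?_
    rw [sum_mul, mul_sum]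
    exact sum_congr rfl fun γ _ => by ring
  rw [h, sum_sum_eq_zero_of_antisymm (fun β γ => strC_swap23 α β γ) (fun β γ => mul_comm _ _), mul_zero]

/-- `Γ(S, Γ(u,u)) = 2 ∑_{αβ} s_α a_β m_{αβ}`. [folklore] -/
theorem Gam_Gam_self_eq (hu : ContDiff ℝ ∞ u) (Q : Matrix (Fin N) (Fin N) ℂ) :
    Gam S (Gam u u) Q =
      2 * ∑ α, ∑ β, matD (frame α) S Q * matD (frame β) u Q * matD (frame α) (matD (frame β) u) Q := by
  show ∑ α, matD (frame α) S Q * matD (frame α) (Gam u u) Q = _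
  simp_rw [matD_Gam_self hu, mul_sum]
  refine sum_congr rfl fun α _ => sum_congr rfl fun β _ => ?_
  ring

/-- `Γ(Γ(S,u), u) = ∑_{αβ} a_α a_β D_αD_β S + ½ Γ(S, Γ(u,u))` (the commutator term vanishes).
[folklore] -/
theorem Gam_Gam_left_eq (hN : N ≠ 0) (hS : ContDiff ℝ ∞ S) (hu : ContDiff ℝ ∞ u)
    (Q : Matrix (Fin N) (Fin N) ℂ) :
    Gam (Gam S u) u Q =
      ∑ α, ∑ β, matD (frame α) u Q * matD (frame β) u Q * matD (frame α) (matD (frame β) S) Q +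
        (1 / 2) * Gam S (Gam u u) Q := by
  have hD : ∀ α : FrameIdx N, matD (frame α) (Gam S u) Q =
      ∑ β, (matD (frame α) (matD (frame β) S) Q * matD (frame β) u Q +
        matD (frame β) S Q * matD (frame α) (matD (frame β) u) Q) := by
    intro α
    have hfun : Gam S u = fun Q => ∑ β, matD (frame β) S Q * matD (frame β) u Q := rfl
    rw [hfun, matD_sum univ (F := fun β Q => matD (frame β) S Q * matD (frame β) u Q)
      (fun β _ => (contDiff_matD hS _).mul (contDiff_matD hu _))]
    refine sum_congr rfl fun β _ => ?_
    rw [matD_fun_mul (contDiff_matD hS _) (contDiff_matD hu _)]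
    ring
  have h0 := sum_sum_comm_mul_eq_zero_right hN hu (fun β => matD (frame β) S Q) Q
  rw [Gam_Gam_self_eq hu Q]
  show ∑ α, matD (frame α) (Gam S u) Q * matD (frame α) u Q = _
  simp_rw [hD]
  have e1 : ∑ α, (∑ β, (matD (frame α) (matD (frame β) S) Q * matD (frame β) u Q +
        matD (frame β) S Q * matD (frame α) (matD (frame β) u) Q)) * matD (frame α) u Q =
      ∑ α, ∑ β, matD (frame α) u Q * matD (frame β) u Q * matD (frame α) (matD (frame β) S) Q +
        ∑ α, ∑ β, matD (frame β) S Q * matD (frame α) u Q * matD (frame α) (matD (frame β) u) Q := by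
    rw [← sum_add_distrib]
    refine sum_congr rfl fun α _ => ?_
    rw [sum_mul, ← sum_add_distrib]
    exact sum_congr rfl fun β _ => by ring
  have e2 : ∑ α, ∑ β, matD (frame β) S Q * matD (frame α) u Q * matD (frame α) (matD (frame β) u) Q =
      ∑ α, ∑ β, matD (frame α) S Q * matD (frame β) u Q * matD (frame α) (matD (frame β) u) Q := by
    rw [sum_comm (f := fun α β => matD (frame α) S Q * matD (frame β) u Q * matD (frame α) (matD (frame β) u) Q)]
    have h : ∑ α, ∑ β, matD (frame β) S Q * matD (frame α) u Q * matD (frame α) (matD (frame β) u) Q -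
        ∑ α, ∑ β, matD (frame β) S Q * matD (frame α) u Q * matD (frame β) (matD (frame α) u) Q = 0 := by
      rw [← sum_sub_distrib]
      simp_rw [← sum_sub_distrib]
      calc ∑ α, ∑ β, (matD (frame β) S Q * matD (frame α) u Q * matD (frame α) (matD (frame β) u) Q -
            matD (frame β) S Q * matD (frame α) u Q * matD (frame β) (matD (frame α) u) Q)
          = ∑ α, ∑ β, (matD (frame α) (matD (frame β) u) Q - matD (frame β) (matD (frame α) u) Q) *
              (matD (frame β) S Q * matD (frame α) u Q) :=
            sum_congr rfl fun α _ => sum_congr rfl fun β _ => by ring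
        _ = 0 := h0
    linarith
  rw [e1, e2]
  ring

/-- **The pointwise twisted Bochner inequality on `SU(2)`** (twist `T_{αβ} = D_αD_β u + (2/5) D_α S D_β u`):
for smooth `S, u` on `M₂(ℂ)` and every `Q`,
`Γ(u,u) ≤ Γ₂^S(u) + H + (2/5) Γ(S,Γ(u,u)) + (1/5) Γ(S,S)Γ(u,u) - (L_S u)²/3 + (2/5) (L_S u) Γ(S,u)`,
`H = ∑ a_α a_β D_αD_β S`.  Ingredients: Bochner's formula in the frame (`Γ₂ = ∑ m² - H`), the expansion
`∑ T² = ∑ m² + (2/5)Γ(S,Γ(u,u)) + (4/25)Γ(S,S)Γ(u,u)`, the dimensional bound for the symmetric part of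
`T` (`(tr T)²/3`, `tr T = Δu + (2/5)Γ(S,u) = L_S u - (3/5)Γ(S,u)`), and for the antisymmetric part the
Ricci identity `¼∑([D_α,D_β]u)² = Γ(u,u)` plus the vanishing of the cross term `∑ [D_α,D_β]u · s_α a_β`.
[folklore] -/
theorem Gam_le_twisted {u S : Matrix (Fin 2) (Fin 2) ℂ → ℝ} (hS : ContDiff ℝ ∞ S) (hu : ContDiff ℝ ∞ u)
    (Q : Matrix (Fin 2) (Fin 2) ℂ) :
    Gam u u Q ≤ Gam2 S u Q +
      ∑ α, ∑ β, matD (frame α) u Q * matD (frame β) u Q * matD (frame α) (matD (frame β) S) Q +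
      (2 / 5) * Gam S (Gam u u) Q + (1 / 5) * (Gam S S Q * Gam u u Q) -
      (1 / 3) * genL S u Q ^ 2 + (2 / 5) * (genL S u Q * Gam S u Q) := by
  -- oddness of the twist in each slot
  have hnegR : ∀ X Y : Matrix (Fin 2) (Fin 2) ℂ, matD X (matD (-Y) u) Q = -matD X (matD Y u) Q := by
    intro X Y
    rw [matD_neg_dir Y u]
    have e : -matD Y u = fun Q => (-1 : ℝ) * matD Y u Q := by
      funext Q'
      simp
    rw [e, matD_const_mul (contDiff_matD hu Y) (-1)]
    simp
  have h1 : ∀ X Y : Matrix (Fin 2) (Fin 2) ℂ,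
      matD (-X) (matD Y u) Q + (2 / 5) * matD (-X) S Q * matD Y u Q =
        -(matD X (matD Y u) Q + (2 / 5) * matD X S Q * matD Y u Q) := by
    intro X Y
    simp only [matD_neg_dir, Pi.neg_apply]
    ring
  have h2 : ∀ X Y : Matrix (Fin 2) (Fin 2) ℂ,
      matD X (matD (-Y) u) Q + (2 / 5) * matD X S Q * matD (-Y) u Q =
        -(matD X (matD Y u) Q + (2 / 5) * matD X S Q * matD Y u Q) := by
    intro X Y
    rw [hnegR]
    simp only [matD_neg_dir, Pi.neg_apply]
    ring
  have hA := sq_sum_diag_add_anti_le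
    (τ := fun X Y => matD X (matD Y u) Q + (2 / 5) * matD X S Q * matD Y u Q) h1 h2
  beta_reduce at hA
  -- the diagonal
  have hdiag : ∑ α, (matD (frame α) (matD (frame α) u) Q + (2 / 5) * matD (frame α) S Q * matD (frame α) u Q) =
      Lap u Q + (2 / 5) * Gam S u Q := by
    simp only [Lap, Gam, sum_add_distrib, mul_sum, mul_assoc]
  -- the antisymmetric part: Ricci term and vanishing cross term
  have hR := sum_sum_sq_comm_matD (N := 2) two_ne_zero hu Q
  simp only [Nat.cast_ofNat] at hR
  have hc1 : ∑ α, ∑ β, (matD (frame α) (matD (frame β) u) Q - matD (frame β) (matD (frame α) u) Q) *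
      (matD (frame α) S Q * matD (frame β) u Q) = 0 :=
    sum_sum_comm_mul_eq_zero_left two_ne_zero hu (fun α => matD (frame α) S Q) Q
  have hc2 : ∑ α, ∑ β, (matD (frame α) (matD (frame β) u) Q - matD (frame β) (matD (frame α) u) Q) *
      (matD (frame β) S Q * matD (frame α) u Q) = 0 :=
    sum_sum_comm_mul_eq_zero_right two_ne_zero hu (fun β => matD (frame β) S Q) Q
  have hpt : ∀ α β : FrameIdx 2,
      (matD (frame α) (matD (frame β) u) Q - matD (frame β) (matD (frame α) u) Q) ^ 2 +
        (4 / 5) * ((matD (frame α) (matD (frame β) u) Q - matD (frame β) (matD (frame α) u) Q) *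
          (matD (frame α) S Q * matD (frame β) u Q)) -
        (4 / 5) * ((matD (frame α) (matD (frame β) u) Q - matD (frame β) (matD (frame α) u) Q) *
          (matD (frame β) S Q * matD (frame α) u Q)) ≤
      (matD (frame α) (matD (frame β) u) Q + (2 / 5) * matD (frame α) S Q * matD (frame β) u Q -
        (matD (frame β) (matD (frame α) u) Q + (2 / 5) * matD (frame β) S Q * matD (frame α) u Q)) ^ 2 := by
    intro α β
    nlinarith [sq_nonneg (matD (frame α) S Q * matD (frame β) u Q - matD (frame β) S Q * matD (frame α) u Q)]
  have hsum := sum_le_sum fun α (_ : α ∈ univ) => sum_le_sum fun β (_ : β ∈ univ) => hpt α β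
  have hsplit : ∑ α, ∑ β, ((matD (frame α) (matD (frame β) u) Q - matD (frame β) (matD (frame α) u) Q) ^ 2 +
        (4 / 5) * ((matD (frame α) (matD (frame β) u) Q - matD (frame β) (matD (frame α) u) Q) *
          (matD (frame α) S Q * matD (frame β) u Q)) -
        (4 / 5) * ((matD (frame α) (matD (frame β) u) Q - matD (frame β) (matD (frame α) u) Q) *
          (matD (frame β) S Q * matD (frame α) u Q))) =
      ∑ α, ∑ β, (matD (frame α) (matD (frame β) u) Q - matD (frame β) (matD (frame α) u) Q) ^ 2 +
        (4 / 5) * ∑ α, ∑ β, (matD (frame α) (matD (frame β) u) Q - matD (frame β) (matD (frame α) u) Q) *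
          (matD (frame α) S Q * matD (frame β) u Q) -
        (4 / 5) * ∑ α, ∑ β, (matD (frame α) (matD (frame β) u) Q - matD (frame β) (matD (frame α) u) Q) *
          (matD (frame β) S Q * matD (frame α) u Q) := by
    simp only [sum_add_distrib, sum_sub_distrib, mul_sum]
  rw [hsplit, hR, hc1, hc2] at hsum
  -- the expansion of `∑ T²`
  have hX1 := Gam_Gam_self_eq (S := S) hu Q
  have hprod : Gam S S Q * Gam u u Q = ∑ α, ∑ β, matD (frame α) S Q ^ 2 * matD (frame β) u Q ^ 2 := by
    rw [Gam_self_eq_sum_sq, Gam_self_eq_sum_sq, sum_mul_sum]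
  have hexp : ∑ α, ∑ β, (matD (frame α) (matD (frame β) u) Q + (2 / 5) * matD (frame α) S Q * matD (frame β) u Q) ^ 2 =
      ∑ α, ∑ β, matD (frame α) (matD (frame β) u) Q ^ 2 + (2 / 5) * Gam S (Gam u u) Q +
        (4 / 25) * (Gam S S Q * Gam u u Q) := by
    rw [hX1, hprod]
    calc ∑ α, ∑ β, (matD (frame α) (matD (frame β) u) Q + (2 / 5) * matD (frame α) S Q * matD (frame β) u Q) ^ 2
        = ∑ α, ∑ β, (matD (frame α) (matD (frame β) u) Q ^ 2 +
            (4 / 5) * (matD (frame α) S Q * matD (frame β) u Q * matD (frame α) (matD (frame β) u) Q) +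
            (4 / 25) * (matD (frame α) S Q ^ 2 * matD (frame β) u Q ^ 2)) :=
          sum_congr rfl fun α _ => sum_congr rfl fun β _ => by ring
      _ = ∑ α, ∑ β, matD (frame α) (matD (frame β) u) Q ^ 2 +
            (4 / 5) * ∑ α, ∑ β, matD (frame α) S Q * matD (frame β) u Q * matD (frame α) (matD (frame β) u) Q +
            (4 / 25) * ∑ α, ∑ β, matD (frame α) S Q ^ 2 * matD (frame β) u Q ^ 2 := by
          simp only [sum_add_distrib, mul_sum]
      _ = _ := by ring
  -- Bochner's formula in the frame
  have hBoch := Gam2_eq two_ne_zero hS hu Q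
  have hL : genL S u Q = Lap u Q + Gam S u Q := rfl
  have hLap : Lap u Q = genL S u Q - Gam S u Q := by rw [hL]; ring
  rw [hdiag, hexp, hLap] at hA
  have hSu0 : 0 ≤ Gam S S Q * Gam u u Q := mul_nonneg (Gam_self_nonneg S Q) (Gam_self_nonneg u Q)
  linarith [hA, hsum, hBoch, hSu0, sq_nonneg (Gam S u Q)]

/-- **The pointwise twisted Bochner inequality for the one-link potential** `S = c Re tr(· B)` on
`SU(2)` (the `N = 2` Hessian term is exact: `H = -(S/2) Γ(u,u)`): for every `Q ∈ M₂(ℂ)`,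
`Γ(u,u) ≤ Γ₂^S(u) + (2/5)Γ(S,Γ(u,u)) + (1/5)Γ(S,S)Γ(u,u) - (S/2)Γ(u,u) - (L_S u)²/3 + (2/5)(L_S u)Γ(S,u)`.
[folklore] -/
theorem Gam_le_twisted_pot (c : ℝ) (B : Matrix (Fin 2) (Fin 2) ℂ) {u : Matrix (Fin 2) (Fin 2) ℂ → ℝ}
    (hu : ContDiff ℝ ∞ u) (Q : Matrix (Fin 2) (Fin 2) ℂ) :
    Gam u u Q ≤ Gam2 (pot c B) u Q + (2 / 5) * Gam (pot c B) (Gam u u) Q +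
      (1 / 5) * (Gam (pot c B) (pot c B) Q * Gam u u Q) - (1 / 2) * (pot c B Q * Gam u u Q) -
      (1 / 3) * genL (pot c B) u Q ^ 2 + (2 / 5) * (genL (pot c B) u Q * Gam (pot c B) u Q) := by
  have h := Gam_le_twisted (contDiff_pot c B) hu Q
  have hH : ∑ α, ∑ β, matD (frame α) u Q * matD (frame β) u Q * matD (frame α) (matD (frame β) (pot c B)) Q =
      -(1 / 2) * pot c B Q * Gam u u Q := sum_sum_hess_potential_two c B Q
  rw [hH] at h
  linarith

/-- `Γ(Γ(S,u),u) = -(S/2) Γ(u,u) + ½ Γ(S,Γ(u,u))` for the one-link potential on `SU(2)`. [folklore] -/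
theorem Gam_Gam_left_pot (c : ℝ) (B : Matrix (Fin 2) (Fin 2) ℂ) {u : Matrix (Fin 2) (Fin 2) ℂ → ℝ}
    (hu : ContDiff ℝ ∞ u) (Q : Matrix (Fin 2) (Fin 2) ℂ) :
    Gam (Gam (pot c B) u) u Q = -(1 / 2) * pot c B Q * Gam u u Q + (1 / 2) * Gam (pot c B) (Gam u u) Q := by
  rw [Gam_Gam_left_eq two_ne_zero (contDiff_pot c B) hu Q]
  have hH : ∑ α, ∑ β, matD (frame α) u Q * matD (frame β) u Q * matD (frame α) (matD (frame β) (pot c B)) Q =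
      -(1 / 2) * pot c B Q * Gam u u Q := sum_sum_hess_potential_two c B Q
  rw [hH]

/-- `L_S S = -(3/2) S + Γ(S,S)` for the one-link potential on `SU(2)`. [folklore] -/
theorem genL_pot_self (c : ℝ) (B Q : Matrix (Fin 2) (Fin 2) ℂ) :
    genL (pot c B) (pot c B) Q = -(3 / 2) * pot c B Q + Gam (pot c B) (pot c B) Q := by
  have h : Lap (pot c B) Q = -(3 / 2) * pot c B Q := Lap_potential_two c B Q
  show Lap (pot c B) Q + Gam (pot c B) (pot c B) Q = _
  rw [h]

end Calculus

end Summit.QuantumFields.BalabanUV.InfraRed.StrongCouplingSharpTwist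

end
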